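import Mathlib
import Literature.Computability.Complexity.ExtMonotoneGates
import Literature.Computability.Complexity.CliqueApproximatorsWide
import Literature.Computability.Complexity.RossmanMonotoneCliqueProb
import Literature.Computability.Complexity.RossmanMonotoneCliqueGraphs
import Literature.Computability.Complexity.ExtMonotoneGRankSupport
import Summits.PneNP.PneNP.Theorems.ConvexRankGatesLinAlgGateBlindDefs
import Summits.PneNP.PneNP.Theorems.LinAlgGateBlind.Negative.DetGate
import Summits.PneNP.PneNP.Theorems.LinAlgGateBlind.Negative.CliquePolyDetRepr

/-!
# Sub-goal `sgAt_gRank_dc_lowerBound` of line `dnf-invariant-wide-gates-see-small-cliques` for crux `LinAlgGateBlind` (stmt-PneNP-10681, route ConvexRankGates)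

CALIBRATION of the lead's research stub `stub_sgGRank` (the single-gate statement `SGAt` for GRANK term
gates): a kernel-checked certificate that the stub is at least Valiant-hard.

`sgAt_gRank_dc_lowerBound`: if `2 ≤ l`, `2 ≤ k ≤ m`, `q ∈ [0,1]`, `ε < 1`,
`Pr_{G(m,q)}[CLIQUE(m,k)] + ε < q^{C(l,2)}`, `d ≤ s`, and `SGAt m (IsGRankGate s) l k q ε` holds, then the
clique polynomial `CL_{m,k}` (tree: `Negative.cliquePoly m F k`) has NO affine determinantal representation
of size `d` over the field `F` (tree: `HasDetRepr`).

Construction. Given `det A = CL_{m,k}` with `A` affine of size `d`, the determinant gate of `A`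
(`Negative.detGate_isGRankGate`, a `GRANK_d ⊆ GRANK_s` gate of arity `#E(K_m)`) fed with the EDGE atoms
`⌈endpts e⌉` (2-vertex sets, members of `𝒱(l)` as `l ≥ 2`; `⌈endpts e⌉(x) = x e`, `atomB_endpts`) computes
the monotone shadow of `det A = CL_{m,k}` (`Negative.detGate_eq_true_iff`), i.e. `CLIQUE(m,k)` itself
(`Negative.shadow_cliquePoly_iff`, `k ≥ 2`). So `O := CLIQUE(m,k)` is a GRANK_s TERM GATE and `SGAt` hands us
a small-clique DNF `⌈𝒜⌉`, `𝒜 ⊆ 𝒱(l)`, with `#lostPos ≤ ε·C(m,k)` and `gainedNeg ≤ ε`. But no `𝒜` works for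
CLIQUE: `𝒜 = ∅` loses all `C(m,k) > ε·C(m,k)` bare `k`-cliques (`cliqueFn_cliqueVec`), and a member `X ∈ 𝒜`
gains at least `Pr[⌈X⌉] - Pr[CLIQUE] ≥ q^{C(l,2)} - Pr[CLIQUE] > ε` of `G(m,q)`
(`Pr[⌈X⌉] = q^{#E(X)}`, `#E(X) ≤ C(#X,2) ≤ C(l,2)`, `prob_forall_eq_true`, `card_edgesIn_le`).

Sources: Valiant 1979 (determinant gates / universality), Alon–Boppana 1987 §3 (clique indicators,
`G(m,q)`); the one-gate construction is the tree's `Negative.DetGate` / `Negative.CliquePolyDetRepr`. [folklore]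
-/

-- `Summit.PneNP.PneNP.…` duplicates `PneNP` BY DESIGN (single-problem summit).
set_option linter.dupNamespace false

noncomputable section

namespace Summit.PneNP.PneNP.Cruxes.LinAlgGateBlind.DnfInvariantWideGatesSeeSmallCliques

open scoped BigOperators
open Finset Literature.Computability.Complexity Razborov
open Summit.PneNP.PneNP.Theorems.LinAlgGateBlind

/-! ### Edge atoms -/

/-- An edge is live for `X` iff both its endpoints lie in `X`. [folklore] -/
theorem isLive_iff_endpts_subset {m : ℕ} (X : Finset (Fin m)) (e : KEdge m) :
    IsLive X e ↔ endpts e ⊆ X :=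
  ⟨fun h v hv => h v ((mem_endpts e v).1 hv), fun h v hv => h ((mem_endpts e v).2 hv)⟩

/-- The only edge live for the endpoint pair of `e` is `e` itself. [folklore] -/
theorem isLive_endpts_iff {m : ℕ} (e e' : KEdge m) : IsLive (endpts e) e' ↔ e' = e := by
  constructor
  · intro h
    have hsub : endpts e' ⊆ endpts e := (isLive_iff_endpts_subset _ _).1 h
    exact endpts_injective
      (Finset.eq_of_subset_of_card_le hsub (by rw [card_endpts, card_endpts]))
  · rintro rfl
    exact (isLive_iff_endpts_subset _ _).2 Finset.Subset.rfl

/-- **The edge atom reads its edge**: `⌈endpts e⌉(x) = x e`. [folklore] -/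
theorem atomB_endpts {m : ℕ} (e : KEdge m) (x : KEdge m → Bool) : atomB (endpts e) x = x e := by
  apply Bool.eq_iff_iff.2
  simp only [atomB, decide_eq_true_eq]
  constructor
  · intro h
    exact h e ((isLive_endpts_iff e e).2 rfl)
  · intro hx e' he'
    rw [(isLive_endpts_iff e e').1 he']
    exact hx

/-- The clique on `X` is present iff all potential edges inside `X` are on. [folklore] -/
theorem cliquePresent_iff_forall_edgesIn {m : ℕ} (X : Finset (Fin m)) (x : KEdge m → Bool) :
    CliquePresent X x ↔ ∀ e ∈ edgesIn X, x e = true := by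
  simp only [CliquePresent, edgesIn, mem_filter, mem_univ, true_and, isLive_iff_endpts_subset]

/-- `Pr_{G(m,q)}[⌈X⌉] = q^{#E(X)}`. [folklore] -/
theorem prob_cliquePresent {m : ℕ} (q : ℝ) (X : Finset (Fin m)) :
    prob q (fun x : KEdge m → Bool => CliquePresent X x) = q ^ #(edgesIn X) := by
  rw [prob_congr fun x => cliquePresent_iff_forall_edgesIn X x, prob_forall_eq_true]

/-- `Pr_{G(m,q)}[⌈X⌉] ≥ q^{C(l,2)}` for `#X ≤ l`, `q ∈ [0,1]`. [folklore] -/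
theorem pow_choose_le_prob_cliquePresent {m l : ℕ} {q : ℝ} (hq0 : 0 ≤ q) (hq1 : q ≤ 1)
    {X : Finset (Fin m)} (hX : #X ≤ l) :
    q ^ (l.choose 2) ≤ prob q (fun x : KEdge m → Bool => CliquePresent X x) := by
  rw [prob_cliquePresent]
  exact pow_le_pow_of_le_one hq0 hq1 ((card_edgesIn_le X).trans (Nat.choose_le_choose 2 hX))

/-! ### CLIQUE is a GRANK term gate whenever `CL_{m,k}` is a small determinant -/

open MvPolynomial in
/-- An affine determinantal representation `det A = CL_{m,k}` of size `d ≤ s` makes `CLIQUE(m,k)` ONE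
`GRANK_s` term gate over the edge atoms (`k ≥ 2`, `l ≥ 2`). [folklore] -/
theorem isTermGate_cliqueFn_of_detRepr {m l k s d : ℕ} {F : Type} [Field F] (hl : 2 ≤ l) (hk : 2 ≤ k)
    (hds : d ≤ s) (A : Matrix (Fin d) (Fin d) (MvPolynomial (Fin (CliqueLPGate.nE m)) F))
    (hA : ∀ i j, (A i j).totalDegree ≤ 1) (hdet : A.det = Negative.cliquePoly m F k) :
    IsTermGate m (IsGRankGate s) l (cliqueFn m k) := by
  refine ⟨_, (Negative.detGate_isGRankGate A).mono hds, fun a => endpts ((CliqueLPGate.eE m).symm a),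
    fun a => ?_, fun x => ?_⟩
  · rw [mem_smallSets, card_endpts]
    omega
  · apply Bool.eq_iff_iff.2
    change cliqueFn m k x = true ↔ decide (d ≤ (symbolicMatrix (A.map (coeff 0))
      (fun i => A.map (coeff (Finsupp.single i 1)))
      (fun a => atomB (endpts ((CliqueLPGate.eE m).symm a)) x)).rank) = true
    rw [Negative.detGate_eq_true_iff A hA, hdet, ← Negative.shadow_cliquePoly_iff (F := F) hk x]
    simp only [atomB_endpts]

/-! ### The calibration -/

/-- **Calibration of `stub_sgGRank`.** `SG` for `GRANK_s` term gates over `≤ l`-atoms (with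
`Pr[CLIQUE(m,k)] + ε < q^{C(l,2)}`, `ε < 1`) forces `dc_F(CL_{m,k}) > s` over every field `F`: an affine
determinantal representation of size `d ≤ s` would make `CLIQUE(m,k)` itself a GRANK_s term gate, and
CLIQUE has no one-sided small-clique DNF approximator (`∅` loses every bare `k`-clique; a member `X` gains
`≥ q^{C(l,2)} - Pr[CLIQUE] > ε` of `G(m,q)`). [folklore] -/
theorem sgAt_gRank_dc_lowerBound : ∀ (m l k s d : ℕ) (q ε : ℝ) (F : Type) [Field F], 2 ≤ l → 2 ≤ k → k ≤ m → 0 ≤ q → q ≤ 1 → ε < 1 → prob q (fun x : KEdge m → Bool => cliqueFn m k x = true) + ε < q ^ (l.choose 2) → d ≤ s → SGAt m (IsGRankGate s) l k q ε → ¬ Literature.Computability.AlgebraicComplexity.HasDetRepr (Summit.PneNP.PneNP.Theorems.LinAlgGateBlind.Negative.cliquePoly m F k) d := by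
  intro m l k s d q ε F _ hl hk hkm hq0 hq1 hε hgap hds hSG
  classical
  rintro ⟨A, hA, hdet⟩
  obtain ⟨𝒜, h𝒜, hlost, hgain⟩ := hSG _ (isTermGate_cliqueFn_of_detRepr hl hk hds A hA hdet)
  rcases 𝒜.eq_empty_or_nonempty with rfl | ⟨X, hX⟩
  · -- `𝒜 = ∅` loses every bare `k`-clique
    have hall : lostPos m k (cliqueFn m k) ∅ = powersetCard k univ := by
      rw [lostPos]
      refine filter_true_of_mem fun S hS => ⟨cliqueFn_cliqueVec (by rw [(mem_powersetCard.1 hS).2]), ?_⟩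
      rintro ⟨W, hW, -⟩
      exact absurd hW (notMem_empty W)
    rw [hall, card_powersetCard, card_univ, Fintype.card_fin] at hlost
    have hpos : (0 : ℝ) < m.choose k := by exact_mod_cast Nat.choose_pos hkm
    nlinarith [mul_pos (sub_pos.2 hε) hpos]
  · -- a member `X ∈ 𝒜` gains too many negatives
    have hXl : #X ≤ l := (mem_smallSets.1 (h𝒜 hX)).1
    have h1 : prob q (fun x : KEdge m → Bool => CliquePresent X x) ≤
        prob q (fun x : KEdge m → Bool => cliqueFn m k x = true) +
          prob q (fun x : KEdge m → Bool => CliquePresent X x ∧ ¬ cliqueFn m k x = true) :=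
      prob_le_prob_add_prob_and_not hq0 hq1 _ _
    have h2 : prob q (fun x : KEdge m → Bool => CliquePresent X x ∧ ¬ cliqueFn m k x = true) ≤
        gainedNeg m q (cliqueFn m k) 𝒜 :=
      prob_mono hq0 hq1 fun x hx => ⟨Bool.eq_false_iff.2 hx.2, X, hX, hx.1⟩
    have h3 := pow_choose_le_prob_cliquePresent (m := m) hq0 hq1 hXl
    linarith

end Summit.PneNP.PneNP.Cruxes.LinAlgGateBlind.DnfInvariantWideGatesSeeSmallCliques

end
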